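import Literature.NumberTheory.Sieve.MoebiusWalshCircuitsGreenProofs
import Literature.NumberTheory.Sieve.MoebiusWalshCircuitsLiouvilleHolds
import HarnessLib

/-!
# Crux `MobiusLadder.LiouvilleOrthogonalTC0` (stmt-QuantumAdvantage-1393), line `Sketch`, skeleton v4:
`stub_ltfCore` — `λ` is orthogonal to every linear threshold function of the binary digits, given a
uniform Fourier-tail bound for threshold functions

Registered stub `stub_ltfCore` of skeleton v4 (lead `prover-line-stmt-QuantumAdvantage-1393-c2-0`,
`Cruxes/LiouvilleOrthogonalTC0/Lines/Sketch.lean`). Statement: if for every `m ≥ 1` and every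
real-weight threshold function `f(x) = [θ ≤ Σ_i w_i x_i]` of `n` Boolean variables the Fourier weight
of `sgn ∘ f` above level `m` is `≤ 3/√m` (Peres' theorem, registered stub `stub_peresTail`), then
for every `ε > 0`, eventually in `n`, every INTEGER threshold function of the `n` binary digits has
`|Σ_{N<2ⁿ} λ(N) · sgn [θ ≤ Σ_i w_i bit_i(N)]| ≤ ε 2ⁿ`.

Proof = Green 2012, §2 (the tree's abstract form `GreenAC0.core_bound`) with BOTH the empty and the
small Walsh characters bounded by Bourgain's uniform Möbius–Walsh bound for `λ`
(`Literature.NumberTheory.Sieve.bourgain_liouville_walsh_holds`: `|Σ_{N<2ⁿ} λ(N) w_A(bits N)| ≤ 2^{n-n^c}`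
for all `A`, eventually in `n`, some `c > 0`) and the tail by the hypothesis at level `k + 1`.
Parameters: `R = ⌈3/c⌉₊`, `k = ⌊n^{1/R}⌋₊` (so `k^R ≤ n < (k+1)^R`, `n^c ≥ k^3`, `(n+1)^k ≤ 2^{Rk²}`):
the small characters cost `(n+1)^k 2^{n-n^c} ≤ 2ⁿ 2^{Rk²-k³} ≤ 2ⁿ 2^{-k}` once `k ≥ R + 1`, and the tail
costs `2ⁿ √(3/√(k+1))`; both are `≤ (ε/3) 2ⁿ` for `k` large, and `k → ∞` with `n`.
-/

set_option linter.dupNamespace false -- D-0017: single-problem summit ⇒ `QuantumAdvantage.QuantumAdvantage` by design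

noncomputable section

namespace Summit.QuantumAdvantage.QuantumAdvantage.Theorems.LiouvilleOrthogonalTC0

open Filter Finset
open Literature.Computability.Complexity
open Literature.Computability.Complexity.LowDegree (tailWeight)
open Literature.Probability.RandomGraphs.LowDegree (sgn walsh walsh_empty)
open Literature.NumberTheory.Sieve

namespace LtfCore

/-! ### Arithmetic of the parameters `R = ⌈3/c⌉₊`, `k = ⌊n^{1/R}⌋₊` -/

/-- `k^R ≤ n` for `k = ⌊n^{1/R}⌋₊`. -/
theorem floor_rpow_pow_le {R : ℕ} (hR : 1 ≤ R) (n : ℕ) :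
    (⌊((n : ℝ)) ^ ((1 : ℝ) / R)⌋₊) ^ R ≤ n := by
  have hn0 : (0 : ℝ) ≤ n := Nat.cast_nonneg n
  have hx0 : (0 : ℝ) ≤ (n : ℝ) ^ ((1 : ℝ) / R) := Real.rpow_nonneg hn0 _
  have h1 : ((⌊((n : ℝ)) ^ ((1 : ℝ) / R)⌋₊ : ℕ) : ℝ) ≤ (n : ℝ) ^ ((1 : ℝ) / R) := Nat.floor_le hx0
  have h2 : (((⌊((n : ℝ)) ^ ((1 : ℝ) / R)⌋₊ : ℕ) : ℝ)) ^ R ≤ ((n : ℝ) ^ ((1 : ℝ) / R)) ^ R :=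
    pow_le_pow_left₀ (Nat.cast_nonneg _) h1 R
  have hRne : (R : ℝ) ≠ 0 := by exact_mod_cast (show R ≠ 0 by omega)
  have h3 : ((n : ℝ) ^ ((1 : ℝ) / R)) ^ R = n := by
    rw [← Real.rpow_natCast, ← Real.rpow_mul hn0, one_div, inv_mul_cancel₀ hRne, Real.rpow_one]
  rw [h3] at h2
  exact_mod_cast h2

/-- `n < (k+1)^R` for `k = ⌊n^{1/R}⌋₊`. -/
theorem lt_floor_rpow_succ_pow {R : ℕ} (hR : 1 ≤ R) (n : ℕ) :
    n < (⌊((n : ℝ)) ^ ((1 : ℝ) / R)⌋₊ + 1) ^ R := by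
  have hn0 : (0 : ℝ) ≤ n := Nat.cast_nonneg n
  have h1 : (n : ℝ) ^ ((1 : ℝ) / R) < (⌊((n : ℝ)) ^ ((1 : ℝ) / R)⌋₊ : ℕ) + 1 := Nat.lt_floor_add_one _
  have hx0 : (0 : ℝ) ≤ (n : ℝ) ^ ((1 : ℝ) / R) := Real.rpow_nonneg hn0 _
  have hRne : (R : ℝ) ≠ 0 := by exact_mod_cast (show R ≠ 0 by omega)
  have h2 : ((n : ℝ) ^ ((1 : ℝ) / R)) ^ R < (((⌊((n : ℝ)) ^ ((1 : ℝ) / R)⌋₊ : ℕ) : ℝ) + 1) ^ R :=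
    pow_lt_pow_left₀ h1 hx0 (by omega)
  have h3 : ((n : ℝ) ^ ((1 : ℝ) / R)) ^ R = n := by
    rw [← Real.rpow_natCast, ← Real.rpow_mul hn0, one_div, inv_mul_cancel₀ hRne, Real.rpow_one]
  rw [h3] at h2
  exact_mod_cast h2

/-- `k = ⌊n^{1/R}⌋₊ → ∞` as `n → ∞`. -/
theorem tendsto_floor_rpow {R : ℕ} (hR : 1 ≤ R) :
    Tendsto (fun n : ℕ => ⌊((n : ℝ)) ^ ((1 : ℝ) / R)⌋₊) atTop atTop := by
  have hpos : (0 : ℝ) < (1 : ℝ) / R := by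
    have : (0 : ℝ) < R := by exact_mod_cast (show 0 < R by omega)
    positivity
  exact tendsto_nat_floor_atTop.comp ((tendsto_rpow_atTop hpos).comp tendsto_natCast_atTop_atTop)

/-- The small-character cost: with `3 ≤ R c`, `k^R ≤ n < (k+1)^R`, `R + 1 ≤ k` and `2^{-k} ≤ η`,
`(n+1)^k · 2^{n - n^c} ≤ η · 2ⁿ`. -/
theorem low_term_le {R k n : ℕ} {c η : ℝ} (hc : 0 < c) (hRc : 3 ≤ (R : ℝ) * c)
    (hkn : k ^ R ≤ n) (hnk : n < (k + 1) ^ R) (hRk : R + 1 ≤ k)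
    (hη : ((2 : ℝ)⁻¹) ^ k ≤ η) :
    ((n : ℝ) + 1) ^ k * (2 : ℝ) ^ ((n : ℝ) - (n : ℝ) ^ c) ≤ η * 2 ^ n := by
  have hk1 : 1 ≤ k := by omega
  have hk1' : (1 : ℝ) ≤ k := by exact_mod_cast hk1
  -- (n+1)^k ≤ 2^(R*k*k)
  have hA : ((n : ℝ) + 1) ^ k ≤ (2 : ℝ) ^ (R * k * k) := by
    have h1 : n + 1 ≤ (k + 1) ^ R := hnk
    have h2 : k + 1 ≤ 2 ^ k := Nat.lt_two_pow_self
    have h3 : (n + 1) ^ k ≤ (2 ^ k) ^ (R * k) := by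
      calc (n + 1) ^ k ≤ ((k + 1) ^ R) ^ k := Nat.pow_le_pow_left h1 k
        _ = (k + 1) ^ (R * k) := by rw [← pow_mul]
        _ ≤ (2 ^ k) ^ (R * k) := Nat.pow_le_pow_left h2 _
    have h4 : ((n : ℝ) + 1) ^ k ≤ (((2 ^ k) ^ (R * k) : ℕ) : ℝ) := by exact_mod_cast h3
    refine h4.trans (le_of_eq ?_)
    push_cast
    rw [← pow_mul]; ring_nf
  -- n^c ≥ k^3
  have hB : ((k : ℝ)) ^ (3 : ℕ) ≤ (n : ℝ) ^ c := by
    have hk0 : (0 : ℝ) ≤ k := Nat.cast_nonneg k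
    have h1 : ((k : ℝ) ^ R : ℝ) ≤ n := by exact_mod_cast hkn
    have h2 : (((k : ℝ) ^ R) : ℝ) ^ c ≤ (n : ℝ) ^ c :=
      Real.rpow_le_rpow (by positivity) h1 hc.le
    have h3 : (((k : ℝ) ^ R) : ℝ) ^ c = (k : ℝ) ^ ((R : ℝ) * c) := by
      rw [← Real.rpow_natCast, ← Real.rpow_mul hk0]
    have h4 : (k : ℝ) ^ ((3 : ℕ) : ℝ) ≤ (k : ℝ) ^ ((R : ℝ) * c) :=
      Real.rpow_le_rpow_of_exponent_le hk1' (by exact_mod_cast hRc)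
    rw [Real.rpow_natCast] at h4
    rw [h3] at h2
    exact h4.trans h2
  -- 2^(n - n^c) ≤ 2^n * 2^(-k^3)
  have hC : (2 : ℝ) ^ ((n : ℝ) - (n : ℝ) ^ c) ≤ 2 ^ n * ((2 : ℝ)⁻¹) ^ (k ^ 3) := by
    rw [Real.rpow_sub (by norm_num : (0 : ℝ) < 2), Real.rpow_natCast, inv_pow, div_eq_mul_inv]
    refine mul_le_mul_of_nonneg_left ?_ (by positivity)
    refine inv_anti₀ (by positivity) ?_
    calc (2 : ℝ) ^ (k ^ 3) = (2 : ℝ) ^ (((k : ℝ)) ^ (3 : ℕ)) := by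
          rw [← Real.rpow_natCast]; push_cast; ring_nf
      _ ≤ (2 : ℝ) ^ ((n : ℝ) ^ c) :=
          Real.rpow_le_rpow_of_exponent_le (by norm_num) hB
  -- R k² - k³ ≤ -k
  have hD : R * k * k + k ≤ k ^ 3 := by
    have : (R + 1) * (k * k) ≤ k * (k * k) := Nat.mul_le_mul_right _ hRk
    nlinarith [this]
  calc ((n : ℝ) + 1) ^ k * (2 : ℝ) ^ ((n : ℝ) - (n : ℝ) ^ c)
      ≤ (2 : ℝ) ^ (R * k * k) * (2 ^ n * ((2 : ℝ)⁻¹) ^ (k ^ 3)) :=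
        mul_le_mul hA hC (by positivity) (by positivity)
    _ = 2 ^ n * ((2 : ℝ) ^ (R * k * k) * ((2 : ℝ)⁻¹) ^ (k ^ 3)) := by ring
    _ ≤ 2 ^ n * ((2 : ℝ)⁻¹) ^ k := by
        refine mul_le_mul_of_nonneg_left ?_ (by positivity)
        obtain ⟨e, he⟩ : ∃ e, k ^ 3 = R * k * k + k + e := ⟨k ^ 3 - (R * k * k + k), by omega⟩
        rw [he, pow_add, pow_add, ← mul_assoc, ← mul_assoc, ← mul_pow,
          mul_inv_cancel₀ (by norm_num : (2 : ℝ) ≠ 0), one_pow, one_mul]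
        refine mul_le_of_le_one_right (by positivity) ?_
        exact pow_le_one₀ (by norm_num) (by norm_num)
    _ ≤ 2 ^ n * η := mul_le_mul_of_nonneg_left hη (by positivity)
    _ = η * 2 ^ n := mul_comm _ _

/-- Eventually in `n`, the parameter `k = ⌊n^{1/R}⌋₊` is past any threshold and the two cost terms
are below `ε/3`. -/
theorem eventually_params {R : ℕ} (hR : 1 ≤ R) {ε : ℝ} (hε : 0 < ε) :
    ∀ᶠ n : ℕ in atTop, R + 1 ≤ ⌊((n : ℝ)) ^ ((1 : ℝ) / R)⌋₊ ∧
      ((2 : ℝ)⁻¹) ^ ⌊((n : ℝ)) ^ ((1 : ℝ) / R)⌋₊ ≤ ε / 3 ∧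
      Real.sqrt (3 / Real.sqrt ((⌊((n : ℝ)) ^ ((1 : ℝ) / R)⌋₊ : ℕ) + 1)) ≤ ε / 3 := by
  have hT := tendsto_floor_rpow hR
  have hε3 : 0 < ε / 3 := by positivity
  -- in the variable k
  have h1 : ∀ᶠ k : ℕ in atTop, R + 1 ≤ k := eventually_ge_atTop _
  have h2 : ∀ᶠ k : ℕ in atTop, ((2 : ℝ)⁻¹) ^ k ≤ ε / 3 :=
    Filter.Tendsto.eventually_le_const hε3
      (tendsto_pow_atTop_nhds_zero_of_lt_one (by norm_num) (by norm_num))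
  have h3 : ∀ᶠ k : ℕ in atTop, Real.sqrt (3 / Real.sqrt ((k : ℕ) + 1)) ≤ ε / 3 := by
    -- it suffices that 3/√(k+1) ≤ (ε/3)^2, i.e. (27/ε²)² ≤ k+1
    refine (eventually_ge_atTop ⌈((27 : ℝ) / ε ^ 2) ^ 2⌉₊).mono fun k hk => ?_
    have hk' : ((27 : ℝ) / ε ^ 2) ^ 2 ≤ (k : ℝ) + 1 := by
      have := (Nat.ceil_le.mp hk)
      have : (((27 : ℝ) / ε ^ 2) ^ 2) ≤ (k : ℝ) := (Nat.le_ceil _).trans (by exact_mod_cast hk)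
      linarith
    have hpos : (0 : ℝ) < 27 / ε ^ 2 := by positivity
    have hsq : (27 : ℝ) / ε ^ 2 ≤ Real.sqrt ((k : ℝ) + 1) := by
      rw [← Real.sqrt_sq hpos.le]
      exact Real.sqrt_le_sqrt hk'
    have hs0 : 0 < Real.sqrt ((k : ℝ) + 1) := hpos.trans_le hsq
    have hq : 3 / Real.sqrt ((k : ℝ) + 1) ≤ (ε / 3) ^ 2 := by
      rw [div_le_iff₀ hs0]
      calc (3 : ℝ) = (ε / 3) ^ 2 * (27 / ε ^ 2) := by field_simp; ring
        _ ≤ (ε / 3) ^ 2 * Real.sqrt ((k : ℝ) + 1) := mul_le_mul_of_nonneg_left hsq (by positivity)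
    calc Real.sqrt (3 / Real.sqrt ((k : ℕ) + 1)) ≤ Real.sqrt ((ε / 3) ^ 2) := Real.sqrt_le_sqrt hq
      _ = ε / 3 := Real.sqrt_sq hε3.le
  exact hT.eventually (h1.and (h2.and h3))

/-- An integer threshold test read over `ℝ`. -/
theorem decide_intLtf_eq {n : ℕ} (w : Fin n → ℤ) (θ : ℤ) (y : Fin n → Bool) :
    decide (θ ≤ ∑ i, w i * (if y i then (1 : ℤ) else 0)) =
      decide ((θ : ℝ) ≤ ∑ i, ((w i : ℤ) : ℝ) * (if y i then (1 : ℝ) else 0)) := by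
  have hcast : (((∑ i, w i * (if y i then (1 : ℤ) else 0) : ℤ)) : ℝ) =
      ∑ i, ((w i : ℤ) : ℝ) * (if y i then (1 : ℝ) else 0) := by
    push_cast
    refine Finset.sum_congr rfl fun i _ => ?_
    split <;> simp
  by_cases h : θ ≤ ∑ i, w i * (if y i then (1 : ℤ) else 0)
  · have h' : (θ : ℝ) ≤ ∑ i, ((w i : ℤ) : ℝ) * (if y i then (1 : ℝ) else 0) := by
      rw [← hcast]; exact_mod_cast h
    rw [decide_eq_true h, decide_eq_true h']
  · have h' : ¬ (θ : ℝ) ≤ ∑ i, ((w i : ℤ) : ℝ) * (if y i then (1 : ℝ) else 0) := by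
      rw [← hcast]; exact_mod_cast h
    rw [decide_eq_false h, decide_eq_false h']

end LtfCore

open LtfCore in
/-- **`λ` is orthogonal to every linear threshold function of the binary digits, given Peres' tail
bound** (registered stub `stub_ltfCore` of skeleton v4). For every `ε > 0`, eventually in `n`, every
integer threshold function `N ↦ [θ ≤ Σ_i w_i bit_i(N)]` of the `n` low binary digits satisfies
`|Σ_{N<2ⁿ} λ(N) sgn[…]| ≤ ε 2ⁿ`, provided every real-weight threshold function of `n` variables has
Fourier weight `≤ 3/√m` above every level `m ≥ 1` (hypothesis; Peres 2004). Proof: Green's §2 bound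
`GreenAC0.core_bound` with the empty and the small characters (`1 ≤ |S| ≤ k = ⌊n^{1/R}⌋₊`,
`R = ⌈3/c⌉₊`) estimated by Bourgain's uniform Walsh bound `bourgain_liouville_walsh_holds`
(`2^{n-n^c}`) and the tail at level `k+1` by the hypothesis. -/
theorem stub_ltfCore
    (hTail : ∀ (n m : ℕ), 1 ≤ m → ∀ (w : Fin n → ℝ) (θ : ℝ),
      tailWeight (fun x : Fin n → Bool =>
          sgn (decide (θ ≤ ∑ i, w i * (if x i then (1 : ℝ) else 0)))) m ≤ 3 / Real.sqrt m) :
    ∀ ε : ℝ, 0 < ε → ∀ᶠ n : ℕ in atTop, ∀ (w : Fin n → ℤ) (θ : ℤ),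
      |∑ N ∈ Finset.range (2 ^ n), ((ArithmeticFunction.liouville N : ℤ) : ℝ) *
          sgn (decide (θ ≤ ∑ i, w i * (if Nat.testBit N i then (1 : ℤ) else 0)))|
        ≤ ε * (2 : ℝ) ^ n := by
  intro ε hε
  obtain ⟨c, hc, hB⟩ := bourgain_liouville_walsh_holds
  -- parameters
  set R : ℕ := ⌈(3 : ℝ) / c⌉₊ with hRdef
  have hR1 : 1 ≤ R := by
    have : (0 : ℝ) < 3 / c := by positivity
    exact Nat.one_le_iff_ne_zero.mpr (Nat.pos_iff_ne_zero.mp (Nat.ceil_pos.mpr this))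
  have hRc : 3 ≤ (R : ℝ) * c := by
    have h1 : (3 : ℝ) / c ≤ R := Nat.le_ceil _
    have := mul_le_mul_of_nonneg_right h1 hc.le
    rwa [div_mul_cancel₀ _ hc.ne'] at this
  filter_upwards [hB, eventually_params hR1 hε] with n hBn hpar w θ
  obtain ⟨hRk, hηk, hτk⟩ := hpar
  set k : ℕ := ⌊((n : ℝ)) ^ ((1 : ℝ) / R)⌋₊ with hkdef
  -- pass to the cube
  rw [MoebiusWalsh.sum_range_two_pow_eq_sum_cube
    (fun N => ((ArithmeticFunction.liouville N : ℤ) : ℝ) *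
      sgn (decide (θ ≤ ∑ i, w i * (if Nat.testBit N i then (1 : ℤ) else 0))))]
  simp only [MoebiusWalsh.testBit_bitsToNat_ofFn]
  -- the threshold function as a real-weight LTF on the cube
  set f : (Fin n → Bool) → ℝ := fun y =>
    sgn (decide ((θ : ℝ) ≤ ∑ i, ((w i : ℤ) : ℝ) * (if y i then (1 : ℝ) else 0))) with hfdef
  have hfy : ∀ y : Fin n → Bool,
      sgn (decide (θ ≤ ∑ i, w i * (if y i then (1 : ℤ) else 0))) = f y := fun y => by
    simp only [hfdef, decide_intLtf_eq]
  simp only [hfy]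
  set G : (Fin n → Bool) → ℝ := fun y =>
    ((ArithmeticFunction.liouville (bitsToNat (List.ofFn y)) : ℤ) : ℝ) with hGdef
  have hG : ∀ y, |G y| ≤ 1 := fun y =>
    Literature.NumberTheory.LFunctions.LiouvilleSum.abs_liouville_le_one _
  have hf : ∀ y, |f y| ≤ 1 := fun y => by
    simp only [hfdef]; unfold sgn; split_ifs <;> simp
  -- Bourgain's bound on the cube, for every character
  set B : ℝ := (2 : ℝ) ^ ((n : ℝ) - (n : ℝ) ^ c) with hBdef
  have hWalsh : ∀ A : Finset (Fin n), |∑ y, G y * walsh A y| ≤ B := by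
    intro A
    have h := hBn A
    rw [MoebiusWalsh.sum_range_two_pow_eq_sum_cube
      (fun N => (ArithmeticFunction.liouville N : ℝ) * walsh A (fun j : Fin n => N.testBit j))] at h
    simp only [MoebiusWalsh.ofFn_testBit_bitsToNat] at h
    exact h
  have h0 : |∑ y, G y| ≤ B := by simpa using hWalsh ∅
  have hB0 : 0 ≤ B := by positivity
  have hcore := GreenAC0.core_bound (k := k) f G hf hG (E₀ := B) (E₁ := B)
    (τ := 3 / Real.sqrt ((k : ℕ) + 1 : ℕ)) hB0 h0 (fun S _ _ => hWalsh S)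
    (by
      have := hTail n (k + 1) (by omega) (fun i => ((w i : ℤ) : ℝ)) (θ : ℝ)
      simpa [hfdef] using this)
  change |∑ y, G y * f y| ≤ ε * 2 ^ n
  refine hcore.trans ?_
  -- the three cost terms
  have hkn : k ^ R ≤ n := floor_rpow_pow_le hR1 n
  have hnk : n < (k + 1) ^ R := lt_floor_rpow_succ_pow hR1 n
  have hlow : ((n : ℝ) + 1) ^ k * B ≤ ε / 3 * 2 ^ n := low_term_le hc hRc hkn hnk hRk hηk
  have hE0 : B ≤ ε / 3 * 2 ^ n := by
    refine le_trans ?_ hlow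
    refine le_mul_of_one_le_left hB0 ?_
    exact one_le_pow₀ (by linarith [(Nat.cast_nonneg n : (0 : ℝ) ≤ n)])
  have htail : (2 : ℝ) ^ n * Real.sqrt (3 / Real.sqrt ((k : ℕ) + 1 : ℕ)) ≤ ε / 3 * 2 ^ n := by
    rw [mul_comm]
    refine mul_le_mul_of_nonneg_right ?_ (by positivity)
    simpa using hτk
  linarith
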